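import Summits.BirchSwinnertonDyer.Rank1Residual.F1Sign2.TranspositionDoorAtTwo
import Summits.BirchSwinnertonDyer.Rank1Residual.F1Sign2.ThetaUnitTransportAtTwo
import Literature.NumberTheory.EllipticCurves.ModularCurve
import Literature.NumberTheory.EllipticCurves.GaloisAction
import HarnessLib.Audit.Tags
import HarnessLib

/-!
# Cell `bsd-f1-sign2` — analytic lens (planner `-an` g24; MEMO-an v1.65 §27): AN-41 «THE KUMMER DEFORMATION IS MODULAR OF LEVEL 4N» — the Kummer class
# `κ_P ∈ H¹(ℚ, E[2])` of a rational point as a modular first-order deformation of `ρ̄_{E,2}` at `2` (carriers `weil`, `iota`, `PointKummerBitAt`, `pointKummerBit`;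
# AN-41a `KummerDeformationModularAtLevelFourN`, AN-41b `CongruentCurvesDigitLawAtTwo`, AN-41c `PrimeLevelScalarDigitLawAtTwo`; -an's kernel lemmas K41.1–3
# and REF1 §207's kernel certificates K207.1–9 live in the sibling `KummerDeformationAtTwoKernel.lean`)

STATEMENTS ONLY (no theorem; `lint.statement-form`), typer -ty g19.  Source: `HOME/MEMO-an-data/g24/lean/Sketch_g24.lean` **4fee0acee7fec01d** (216 l., ns `…F1Sign2.ANg24`;
its AN-41 part, l.1–169, is byte-identical — but for one added `import` line — to the text REF1 audited, `HOME/REF1-data/b207/Sketch_g24.lean` **050683ca6b10fc87** = the crux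
workfile `Cruxes/RankOneAtTwoBigImageOddLocal/KummerDeformationAN41.lean` of 15:00Z; the AN-42 tail §27.9 «octahedral avatar», l.170–214 + `K42_Octahedral.lean`, is NOT
ported here — REF-GATED until REF1 audits it) and REF1's `HOME/REF1-data/b207/Probe207.lean` **3a23417ad62b71fa** (= the audited sketch VERBATIM under `…ANg24`-sibling ns
`…F1Sign2.REF1s207` + 3 sorry probes + sorry-free K207.1–9; farm rc 0 · exactly 3 sorries · axioms std).  PORT GATE = REF1-AUDIT §207 R207a (INBOX 2026-08-29T15:24Z):
Props VERBATIM (bodies byte-identical to the sketch AND Probe207, builder-verified); `@[conjecture]` on AN-41a and AN-41c, AN-41b a plain `def … : Prop` (THEOREM-CANDIDATE,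
paper proof in §207); carriers `PointKummerBitAt` (on `W.Δ.num` = `Δ` under `IsIntegral ℤ`) / `pointKummerBit` / `weil` / `iota` VERBATIM; -an's `heckeDefect` is NOT
re-declared — it is byte-identical to AN-40's `…F1Sign2.ANg23.heckeDefect` (`ThetaUnitTransportAtTwo.lean`, -an g23), imported and opened BY NAME here (R207a; typer rule:
cite an existing decl rather than re-declare), so every occurrence of `heckeDefect` below elaborates to the AN-40 carrier.  CITE KEYS (typer, verified on the held texts):
the sketch's cite tag «CalegariEmerton2005, Thm. 1.1» means Calegari–Emerton «Elliptic curves of odd modular degree» (arXiv math/0503359, Israel J. Math. 169 (2009)) — tree key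
`CalegariEmerton2009` (the tree's `CalegariEmerton2005` is their Inventiones «ramification of Hecke algebras at Eisenstein primes» paper, NOT meant); locators in arXiv
numbering: main theorem = Thm. 1 (journal Thm. 1.1), the explicit level-`4N` `𝔽₂[x]/(x²)`-deformation device = §3.3–3.4 with Lemma 16 (held text p0006 L86–140, p0007
L13–30: `h = h₁ + x(h₂−h₁)/2 ∈ S₁(Γ₁(4N))`, × Eisenstein ⟹ `S₂(Γ₀(4N), 𝔽₂[x]/(x²))`, `U₂` ⟹ `2N`, Artinian level lowering ⟹ `N` — the SCALAR direction `ρ̄ ⊗ (1 + x·χ)`,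
not the Kummer directions `t_P`); Dummigan «On a conjecture of Watkins», JTNB 18 (2006), key `Dummigan2006`: the squaring map `Sel₂(E) → H¹(ℚ, Sym²E[2])` = (reduced)
tangent space of the 2-adic deformation ring is §1 (p. 346) with §4–5, `Sym²V ≅ Ad⁰ρ̄` = trace-zero matrices is §2 (p. 347–348), and Dummigan's standing hypotheses §2 (1)–(4)
(N EVEN squarefree, `E[2]` ramified at all `p ∣ N`, no rational 2-torsion, `E(ℝ)` connected) do NOT cover prime `N` (REF2 v54 §17.2) — the sketch's `§2–3` locator on
AN-41a is re-pointed to `§1, §4–5`; AN-41b's `§2` kept (it is the `Ad⁰ = Sym²` dictionary).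
GRADES (REF1-AUDIT §207, `HOME/REF1-AUDIT-v1.md`; evidence `HOME/REF1-data/b207/` SHA16.txt: `scan41.py`/`scan41.txt` 67281c9911ab9dec/96b40f3c058bd4f9, `xtab41.txt`,
`pred41c.py`/`pred41c.txt`): **0 KILLED, 3 SURVIVE** — AN-41a conjecture-grade (not vacuous: K207.6/K207.7; degenerate `P = O` TRUE with `G = 0`); AN-41b THEOREM-GRADE
(paper proof: `M = h·1 + ι∘c`, `(c, ρ̄) : G_ℚ → E[2] ⋊ GL₂(𝔽₂) = AGL₂(𝔽₂) ≅ S₄`, digit bit = `[Frob_ℓ a 4-cycle]`, `g` = quartic field polynomial of a point-stabiliser or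
`X⁴`; degenerate `W′ = W` TRUE: K207.8; split-prime prediction 1 262/1 262); AN-41c THEOREM-GRADE AND DECIDED (REF1's Kummer formula: `h|_{G_{ℚ(E[2])}} = κ(16δδ′)`,
`δ = ∏_{i<j}(eᵢ − eⱼ)` on the equivariantly matched 2-torsion abscissae, `(16δδ′)² = ΔΔ′` EXACTLY = ES-30b's normalisation WITH A SIGN; `h ∈ {χ_D, χ_D·χ_Δ}` (K207.9);
at `N = N′` prime: type `1` ⟺ `D ∈ {1, Δ}·ℚ²`, type `χ₋₄` ⟺ `−D ∈ {1, Δ}·ℚ²`; falsifier widened from -an's 26 pairs (`N < 5000`) to the 213 congruent pairs with `ρ̄` onto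
at prime `N < 5·10⁵`: types 129 `1` / 84 `χ₋₄` / 0 other (3 345 odd-trace prime tests), predicted from the cubics alone 213/213; `χ₋₄`-type ⟹ ordinary at `2` 84/84,
common supersingular `2` ⟹ type `1` 62/62; 14 pure-scalar pairs, among them **7057a1/7057b1: `a ≡ a′ (mod 4)` at all 43 primes `≤ 193`** — candidate `E[4] ≅ E′[4]`
between non-isogenous prime-conductor curves, a datum allowed by 41b/41c).  R207b (-an memo hygiene: §27.5 «13/13» is 12/14 by -an's own `k3_pairs_out.txt`; the
«invisible» character is `sgn∘ρ̄ = χ_{ℚ(√Δ)}`, not `χ_{N*}` — they agree on 3-cycle primes) is recorded on the AN-41c row; R207c(i) (the decided law as an `↔` once a tree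
carrier for matched 2-torsion abscissae exists — none yet; «the dichotomy form needs no carrier and is the right thing to port now») NOT applied: VERBATIM.
REF2-PLACEMENT v54 §17 (15:2xZ; §17.5 after REF1 §207): AN-41a **NEW-COMBINATION / NOT IN PRINT**, conjecture-grade (levers in print on this circle: Dummigan's squaring map
`Sel₂ →` tangent space, CE 2009's explicit level-`4N` modular `𝔽₂[x]/(x²)`-deformations (their words, p0003 L57–66: «instead of appealing to any general modularity
results, we show that 𝕋_𝔪 is bigger than ℤ₂ by explicitly constructing (in certain situations) non-trivial deformations of ρ̄_𝔪 to 𝔽₂[x]/(x²) that are demonstrably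
modular»), θ-transport (AN-40s); the JOIN — Selmer/Kummer directions made explicit and modular at level `4N` at GOOD reduction at `2`, with the `a₂`-parity multiplicity
law — unpublished; as a theorem it would be a fragment of `R^{Sel} = 𝕋(4N)_𝔪` at `p = 2` for `S₃`-image `ρ̄`, OPEN IN PRINT: CE p0003 L76–93, Dummigan p. 347, CG 2018
Rem. 3.31); AN-41b **SUPPORT** (print-assembly: v53 §6.3 (T1) first-order trace expansion, (T2) transposition-prime trace theorem, (T3) the `S₄`-field = `ℚ(x(E[4]))`
[Yelton 2015 Thm. 3.1]); AN-41c **SUPPORT** = the equal-prime-level corner of ES-30b `ScalarCharacterLaw` (`F1Sign2/ScalarCharacterAtTwo.lean`, -es g20: `ψ = χ_D`,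
`D² = Δ_WΔ_{W′}`): at `N = N′` prime `D = ±N^k`, on `a_ℓ`-odd (3-cycle) primes `χ_{±N}(ℓ) = 1`, so `ψ(ℓ) ∈ {1, χ₋₄(ℓ)}` — its 26/26 → 213/213 is a cross-check of
ES-30 at equal level, now with REF1's explicit sign.  BC5 (MEMO-an §27, `HOME/MEMO-an-data/g24/`: census K1 kit j332386 `k1full-hecke4N-N700-an24` (PARI `mfinit([4N,2,1],0)` +
`mfheckemat`, exact linear algebra over `𝔽₂`, the 43 prime levels `N < 700`): 37/37 Kummer directions of the 33 rank `≥ 1` curves realised with 0 misfits (`ℓ ≤ 250`,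
`n ≤ 24`), 6/6 non-congruent cross-controls NOT realised; K2; pair census K3 `ana/k3_pairs.py` → `k3_pairs_out.txt` ebebbed5c4a89b2a, 26 pairs).  Cheapest falsifiers
(R207d): 41a — K1 at the rank `≥ 1` prime levels `700 < N < 2000` and at levels with `Ш[2]`-directions (571-type), one kit job on -an's engine; 41b/41c need no further
data (the 187 pairs with `N > 5000` are congruence-SCREENED at 43 primes, not Sturm-certified — harmless, the Kummer prediction uses no `a_p`).  Why novel (one sentence,
-an §27.7 + REF2 §17.2): neither Dummigan 2006 nor Calegari–Emerton 2009 has the digit formula, the level-`4N` multiplicity-three realisation of the KUMMER (transvection)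
directions, or the weight-3/2 reading.  PARTITION none.  Beyond-print theorem: no (41b/41c provable, not yet in the tree; 41a conjecture).  BSD is not proved; 23715
not closed.  bears_on: stmt-BirchSwinnertonDyer-23715.

## -an's module docstring of `Sketch_g24.lean` (verbatim; «26/26» = -an's K3 census at `N < 5000`, REF1 §207: 213/213 at `N < 5·10⁵`, and «13/13» reads 12/14 — R207b)

# Cell `bsd-f1-sign2`, lens `-an` g24 — AN-41 THE KUMMER CLASS AS A MODULAR FIRST-ORDER DEFORMATION AT `2`
# (sketch; statements only; nothing here proves BSD; crux 23715 not closed)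

THE `p = 2` ACCIDENT.  For `ρ̄ = ρ̄_{E,2} : G_ℚ ↠ GL₂(𝔽₂) ≅ S₃` the trace-zero matrices split AS A GALOIS MODULE:
`sl₂(𝔽₂) = 𝔽₂·I ⊕ V`, `V = {0, τ₁, τ₂, τ₃}` = zero together with the three involutions (= transvections) of `GL₂(𝔽₂)`,
and `v ↦ τ_v` (the transvection fixing `v`, `0 ↦ 0`) is a `G_ℚ`-LINEAR isomorphism `E[2] ≅ V` (kernel lemmas K41.1–3 below,
`decide`).  Hence two lifts `ρ, ρ' : G_ℚ → GL₂(ℤ/4)` of the same `ρ̄` differ by `ρ' = (1 + 2(h·I + τ_c))ρ` with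
`h ∈ Hom(G_ℚ, 𝔽₂)` (a quadratic character: `1 + 2h = χ_D (mod 4)`) and `c ∈ Z¹(G_ℚ, E[2])`, and (K41.2)
  **`a_ℓ(E') − a_ℓ(E) ≡ 2·( h(ℓ)·a_ℓ(E) + t_c(ℓ) ) (mod 4)`**,  `t_c(ℓ) = [ρ̄(Frob_ℓ) is an involution τ_w and c(Frob_ℓ) ∉ {0,w}]`
`= [Frob_ℓ is a 4-cycle in the S₄-extension cut out by c]` (`0` at split and at `3`-cycle primes; a class function of `[c]`).
For the KUMMER class `c = κ_P` of `P ∈ E(ℚ)`: `t_P(ℓ) = [Frob_ℓ transposition on E[2] ∧ P mod ℓ ∉ 2Ẽ(𝔽_ℓ)]` — the Kummer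
line bit of MEMO-an §26 (AN-40), now generator-wise.
AN-41a (CONJECTURE, the mechanism): the first-order deformation `ρ̄ ⊗ (1 + ε τ_{κ_P})` IS MODULAR OF LEVEL `4N` over `𝔽₂[ε]`:
there are a nonzero old-vector `v ∈ ⟨f̄_E, f̄_E|V₂, f̄_E|V₄⟩` and an integral weight-2 cusp form `G` on `Γ₀(4N)` with
`(T_ℓ − a_ℓ) G ≡ t_P(ℓ)·v (mod 2)` for all `ℓ ∤ 2N` (first typing `v = f̄_E` falsified on `a₂`-odd curves by census K1).
Census (kit K1, PARI `mfinit([4N,2,1],0)` + `mfheckemat`, exact linear algebra over `𝔽₂`, 43 prime levels `N < 700`): the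
generalized `𝔽₂`-eigenspace of `𝕋(4N)` at `𝔪_E` realizes EVERY tested Kummer direction `κ_P`, `P ∈ E(ℚ)`, of every curve of rank
`≥ 1` (37/37, 0 misfits; rank 2 included) — with multiplicity `3` (on `f̄, f̄|V₂, f̄|V₄`) when `a₂` is even and once (on
`f̄ + f̄|V₂`) when `a₂` is odd — next to the universal scalar direction `h₄·ā` (`χ₋₄`) and directions cut out by OTHER newforms
congruent to `f_E`; at the 8 rank-0 systems without congruences only `h₄·ā` occurs (MEMO-an §27.4); the Kohnen–θ transport `Ĝ = g̃θ` of §26 lies in socle layer 2–3 of the same module and reads the same `t_P`.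
AN-41b (THEOREM-CANDIDATE, pure Galois theory mod 4 + K41): congruent curves' digit differences are `χ_D`-twist plus a 4-cycle bit.
AN-41c (CONJECTURE, census 26/26 congruent optimal pairs of equal prime conductor `N < 5000`): the scalar character is `1` or `χ₋₄`
(never `χ_{±8}`, `χ_{±N}`), i.e. on `a_ℓ`-odd primes `a_ℓ(E') ≡ a_ℓ(E)` for all `ℓ` or `a_ℓ(E') ≡ χ₋₄(ℓ) a_ℓ(E)` for all `ℓ` (mod 4).
Nearest print: Dummigan, JTNB 18 (2006) 345–355 (squaring map `Sel₂(E) → H¹(ℚ, Sym²E[2])`, tangent space of the 2-adic deformation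
ring, Watkins' `2^r ∣ deg φ`); Calegari–Emerton, arXiv:math/0503359 Thm 1.1 (`𝕋_𝔪 ≠ ℤ₂` via explicit `𝔽₂[x]/(x²)`-deformations,
"in certain situations"); neither has the digit formula, the level-`4N` multiplicity-three realization, or the weight-3/2 reading.
-/

namespace Summit.BirchSwinnertonDyer.Rank1Residual.F1Sign2.ANg24

open Literature.NumberTheory.EllipticCurves Literature.NumberTheory.EllipticCurves.ModularForms UpperHalfPlane
open Summit.BirchSwinnertonDyer.Rank1Residual.F1Sign2
open Summit.BirchSwinnertonDyer.Rank1Residual.F1Sign2.TranspositionDoor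
open scoped ModularForm
open CongruenceSubgroup
open Summit.BirchSwinnertonDyer.Rank1Residual.F1Sign2.ANg23 (heckeDefect)

/-! ### §41.0 Kernel lemmas: `sl₂(𝔽₂) = 𝔽₂ ⊕ E[2]` and the digit trace formula (decidable, `Fin 2`, `ZMod 2`)
(Typer: the carriers `weil`, `iota` are declared here; -an's six kernel THEOREMS K41.1–3 (`iota_add`, `iota_conj`, `sl2_decomp`, `sl2_direct`, `trace_iota_mul`,
`bit_coboundary`) and REF1's K207.1–9 are filed in the sibling `KummerDeformationAtTwoKernel.lean` — statement files carry no theorems.) -/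

/-- The symplectic (Weil) form on `𝔽₂²`: `⟪v, w⟫ = v₀w₁ + v₁w₀ = det(v | w)`.
(Typer -ty g19: carrier VERBATIM; REF1 §207 K207.1: for `w ≠ 0`, `(ι w) v ≠ v ↔ weil w v = 1` — the digit bit is the Weil pairing with the fixed vector; kernel file.) -/
def weil (v w : Fin 2 → ZMod 2) : ZMod 2 := v 0 * w 1 + v 1 * w 0

/-- `ι v` = the transvection `w ↦ w + ⟪v,w⟫ v` fixing `v` for `v ≠ 0`, and `ι 0 = 0`:  the `G`-linear map `E[2] → sl₂(𝔽₂)`.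
(Typer: carrier VERBATIM; -an's K41.1/1′/1″/1‴/2/3 (`iota_add`, `iota_conj`, `sl2_decomp`, `sl2_direct`, `trace_iota_mul`, `bit_coboundary`, all `decide`) and REF1's K207.1′ (the
involutions of `GL₂(𝔽₂)` are exactly the `ι w`, `w ≠ 0`), K207.2–4, K207.9 are THEOREMS in the sibling `KummerDeformationAtTwoKernel.lean`; REF1 §207 (A1): std axioms.) -/
def iota (v : Fin 2 → ZMod 2) : Matrix (Fin 2) (Fin 2) (ZMod 2) :=
  fun i j => (if v = 0 then 0 else if i = j then 1 else 0) + v i * v (1 - j)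

open scoped Classical

/-! ### §41.1 The point Kummer bit and AN-41a -/

/-- **Point Kummer bit** of `P ∈ E(ℚ)` at an odd prime `p`: Frobenius at `p` is a TRANSPOSITION on `E[2]` (`(Δ/p) = −1`, one
root of the 2-division cubic) AND `P mod p ∉ 2Ẽ(𝔽_p)` (tree `reducePointAt`); equivalently `Frob_p` is a `4`-cycle in
`Gal(ℚ(E[2], ½P)/ℚ) ↪ S₄`; `= t_{κ_P}(p)` of K41.2.  (At `p` of bad reduction the value is junk; the laws exclude `p ∣ 2N`.)
(Typer -ty g19: carrier VERBATIM, REF1 §207 (A2) read-back SOUND: `reducePointAt` is the genuine reduction map (junk only at singular reduction; `jacobiSym Δ p = −1 ⟹ p ∤ Δ ⟹`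
good, so no junk inside); `W.Δ.num = Δ` under `IsIntegral ℤ`; at `p = 2` the bit is `0` (irrelevant, the laws exclude `ℓ = 2`); `= [ℓ transposition prime ∧ P ∉ 2E(ℚ_ℓ)]`
by Hensel (tree `exists_smul_reducePointAt_iff_exists_smul_padic`) = the Kummer digit `t_P(ℓ) = ⟪w_ℓ, κ_P(Frob_ℓ)⟫` (K207.1/1′).  K207.5: `¬ PointKummerBitAt W 0 p` (kernel file).) -/
def PointKummerBitAt (W : WeierstrassCurve ℚ) [W.IsIntegral ℤ] (P : W.toAffine.Point) (p : ℕ) : Prop :=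
  ∃ hp : p.Prime, jacobiSym W.Δ.num p = -1 ∧
    ∀ Q : (@reductionAtPrime W _ p ⟨hp⟩).toAffine.Point, @reducePointAt W _ p ⟨hp⟩ P ≠ 2 • Q

/-- The point Kummer bit as an integer `0/1`.
(Typer: carrier VERBATIM; K207.5′ `pointKummerBit W 0 p = 0`; additivity `t_{P+Q} = t_P + t_Q` is K207.4 + K41.3 on the class (kernel file).) -/
noncomputable def pointKummerBit (W : WeierstrassCurve ℚ) [W.IsIntegral ℤ] (P : W.toAffine.Point) (p : ℕ) : ℤ :=
  if PointKummerBitAt W P p then 1 else 0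

/-! (Typer -ty g19: -an's carrier `heckeDefect` — «the mod-2 HECKE DEFECT `(T_ℓ − a_ℓ) z` on integer sequences (exact modulo `2` for odd `ℓ`; copy of -an g23's
`heckeDefect`): `(θ_ℓ z)(n) = z(ℓn) + [ℓ ∣ n] z(n/ℓ) + a_ℓ z(n)`» — is NOT re-declared: its sketched body is byte-identical to AN-40's
`Summit.BirchSwinnertonDyer.Rank1Residual.F1Sign2.ANg23.heckeDefect` (`ThetaUnitTransportAtTwo.lean` l.179–180), which is imported and opened by name above, so
`heckeDefect` in AN-41a below IS the AN-40 carrier (REF1 §207 R207a; typer rule).) -/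

/-- **AN-41a `KummerDeformationModularAtLevelFourN` (CONJECTURE of this lens — the mechanism behind AN-40).**
`E/ℚ` of PRIME conductor `N` with surjective mod-`2` image, `P ∈ E(ℚ)` ANY rational point.  Then the first-order deformation of
`ρ̄_{E,2}` along the Kummer class `κ_P ∈ H¹(ℚ, E[2])` is MODULAR OF LEVEL `4N`: there are a nonzero old-vector
`v = ε₁ f̄ + ε₂ f̄|V₂ + ε₄ f̄|V₄` (`εᵢ ∈ {0,1}`, not all `0`) and a weight-`2` cusp form `G` on `Γ₀(4N)` with integer
`q`-coefficients `z` such that for every prime `ℓ ∤ 2N` and `n ≥ 1`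
  `(T_ℓ − a_ℓ) z (n) ≡ t_P(ℓ) · (ε₁ a_n + ε₂ a_{n/2} + ε₄ a_{n/4}) (mod 2)`,
i.e. `v + ε Ḡ` is a `𝕋(4N)`-eigenform over `𝔽₂[ε]` with `T_ℓ ↦ a_ℓ + ε t_P(ℓ)` (`t_P` = the point Kummer bit = K41.2's
`t_{κ_P}`).  (`P ∈ 2E(ℚ) + E(ℚ)_{tors}` ⇒ `t_P ≡ 0`, witness `G = 0`; the content is at `P ∉ 2E(ℚ)`.)  FIRST TYPING (target
`v = f̄` only) was FALSIFIED by census K1 on the `a₂`-odd curves (53a1, 61a1, 79a1, 83a1, 89a1, …: `t_P` is realized on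
`f̄ + f̄|V₂`, not on `f̄`); on `a₂`-even curves it is realized on each of `f̄, f̄|V₂, f̄|V₄`.  Census K1 (kit j332386, exact linear
algebra over `𝔽₂`, 43 prime `N < 700`, all `51` mod-2 eigensystems): `37/37` Kummer directions of the `33` curves of rank `≥ 1`
realized in their own generalized eigenspace with `0` misfits (`ℓ ≤ 250`, `n ≤ 24`; rank-2 levels 389, 433 with all three
nonzero classes of `E(ℚ)/2E(ℚ)`, 563, 571, 643 with one generator), `6/6` non-congruent cross-controls NOT realized (10–31 misfits).  Why it might
fail: a level with `Ш(E)[2] ≠ 0` or a non-Gorenstein `𝕋(4N)_𝔪` where the Kummer direction needs level `8N` or `16N`; rank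
`≥ 2` beyond `N < 700`.  [cite: Dummigan2006, §1, §4–5] [cite: CalegariEmerton2009, Thm. 1, §3.3–3.4 with Lemma 16 (arXiv numbering)]
(Typer -ty g19, REF1-AUDIT §207: **SURVIVES, conjecture-grade** — filed VERBATIM with `@[conjecture]` (R207a).  (A2): `W.LFunction` is the tree's `a_n`-SEQUENCE, so
`heckeDefect (fun m => W.LFunction m) ℓ z ≡ (T_ℓ − a_ℓ) z (mod 2)` for odd `ℓ ∤ 4N` in weight 2 and `a_n, a_{n/2}, a_{n/4}` are the q-expansions of `f, f|V₂, f|V₄`; the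
clause at 3-cycle / split primes (`t_P = 0`) demands `(T_ℓ − ā_ℓ)Ḡ = 0` there = census K1's «0 misfits incl. 3-cycle part 0» reading; quantifier order `∀ P ∃ (G, e)`; the
typed `∀ P` form is stronger than «for a basis» (the `G`'s add along the SAME `(e₁,e₂,e₄)`-line only; K1 tested 37 directions incl. all three classes of 389a1, 433a1).  BC7:
NOT vacuous — `¬(Even e₁ ∧ Even e₂ ∧ Even e₄) ⟺ v̄ ≠ 0` (K207.7, `a₁ = 1`, read `n = 1, 2, 4`); `P = O`, odd torsion, `P ∈ 2E(ℚ)`: `t_P ≡ 0` (K207.5) and the conclusion is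
TRUE with `G = 0, (e₁,e₂,e₄) = (1,0,0)` (K207.6, sorry-free) — so on rank-0 curves the row is true and EMPTY of content, as billed; for `P ∉ 2E(ℚ) + tors` the witness
`G` is a genuine non-eigen generalised eigenvector.  Exposure (REF1): rank `≥ 1` prime levels `N > 700`, levels with `Ш[2] ≠ 0` sharing `𝔪` (571: the two non-unit
classes), non-Gorenstein `𝕋(4N)_𝔪` — cheapest falsifier R207d(i), one K1-type kit job.  REF2 v54 §17.2: NEW-COMBINATION / NOT IN PRINT; CE 2009's printed level-`4N`
device realises the SCALAR direction `ρ̄ ⊗ (1 + x·χ)` only; an `R^{Sel} = 𝕋` theorem at `2` for dihedral `ρ̄` is open in print (CE p0003 L76–93; Dummigan p. 347;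
Calegari–Geraghty 2018 Rem. 3.31).  «`h ∈ Hom(G_ℚ, 𝔽₂)`» of the module docstring is defined only modulo `sgn∘ρ̄ = χ_{ℚ(√Δ)}` (K207.9) — immaterial here.  Cite
locators re-pointed by the typer (see the module docstring: `CalegariEmerton2005` ↦ `CalegariEmerton2009`, arXiv numbering; Dummigan `§2–3` ↦ `§1, §4–5`).) -/
@[conjecture] def KummerDeformationModularAtLevelFourN : Prop :=
  ∀ (W : WeierstrassCurve ℚ) [W.IsElliptic] [W.IsGloballyMinimal] [W.IsIntegral ℤ] [NeZero (W.conductorNorm ℤ)],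
    (W.conductorNorm ℤ).Prime → W.HasSurjectiveModNGaloisRep 2 →
    ∀ P : W.toAffine.Point,
      ∃ (G : CuspForm (Gamma0 (4 * W.conductorNorm ℤ)) 2) (z : ℕ → ℤ) (e₁ e₂ e₄ : ℤ),
        ¬ (Even e₁ ∧ Even e₂ ∧ Even e₄) ∧
        (∀ n : ℕ, cuspCoeff G n = (z n : ℂ)) ∧
        ∀ ℓ : ℕ, ℓ.Prime → ℓ ≠ 2 → ℓ ≠ W.conductorNorm ℤ →
          ∀ n : ℕ, 0 < n →
            Even (heckeDefect (fun m => W.LFunction m) ℓ z n - pointKummerBit W P ℓ *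
              (e₁ * W.LFunction n + e₂ * (if 2 ∣ n then W.LFunction (n / 2) else 0) +
                e₄ * (if 4 ∣ n then W.LFunction (n / 4) else 0)))

/-! ### §41.2 AN-41b — the digit law for congruent curves (THEOREM-CANDIDATE) -/

/-- **AN-41b `CongruentCurvesDigitLawAtTwo` (THEOREM-CANDIDATE: Galois representations mod `4` + K41.1–3 + the quartic /
cubic-resolvent dictionary).**  `E, E'/ℚ` with `ρ̄_{E,2}` surjective and `a_ℓ(E) ≡ a_ℓ(E') (mod 2)` at all common good odd primes.
Then there are a nonzero integer `D`, a monic integer quartic `g` and a finite exceptional set `S` of primes such that for every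
prime `ℓ ∉ S`:
  `a_ℓ(E') − a_ℓ(E) ≡ 2·( [a_ℓ(E) odd]·[(D/ℓ) = −1] + [g irreducible mod ℓ] ) (mod 4)`.
(`D` ↔ the scalar part `h`, `1 + 2h = χ_D`; `g` ↔ the `E[2]`-part `c`: the `S₄`-quartic with cubic resolvent `ℚ(E[2])` cut out
by `c`, irreducible mod `ℓ` iff `Frob_ℓ` is a `4`-cycle; `c = 0` ↦ any `g` reducible mod every `ℓ`, e.g. `X²(X−1)²`.)
Why it might fail: only through the typing (junk `frobeniusTrace` at bad primes is excluded by `S`); mathematically it is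
K41 + `ρ_{E',4} ≡ (1 + 2d)ρ_{E,4}` + Chebotarev-free pointwise trace comparison; `ρ̄_E ≅ ρ̄_{E'}` follows from the mod-2
congruence because an `S₃`-cubic field is determined by its inert primes.  Census: 26/26 congruent optimal pairs of prime
conductor `< 5000`, `p ≤ 700…2500`, explicit `(D, c)` (MEMO-an §27.3). [cite: Dummigan2006, §2 (context only: Sym²V = Ad⁰ρ̄ = the trace-zero matrices, p. 347–348)]
[cite: Yelton2015, Thm. 3.1, Prop. 2.8 (the S₄-quartic field: the field of the 4-torsion abscissae is the 2-division field with √(a₁a₂), √(a₂a₃), √(a₃a₁) adjoined, aᵢ = differences of the 2-torsion abscissae)]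
(Typer -ty g19, REF1-AUDIT §207: **SURVIVES, THEOREM-GRADE** — filed VERBATIM as a plain `def … : Prop` (THEOREM-CANDIDATE, R207a).  (A2): no level condition on
`W′` — correct (`S` absorbs `2`, the bad primes, `disc g`, the index); `frobeniusTrace` at bad `ℓ ∈ S` is never read.  Paper proof (§207): congruence on a density-1 set +
`ρ̄_W` onto ⟹ `ρ̄_{W′} ≅ ρ̄_W` (Brauer–Nesbitt); `ρ′ = (1 + 2M)ρ`, `tr M = 0`, `M = h·1 + ι∘c` (K41.1–1‴), `h = χ_D`, `c ∈ Z¹(G_ℚ, E[2])`;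
`a′_ℓ − a_ℓ ≡ 2(h(F)·a_ℓ + [ρ̄(F) involution ∧ ρ̄(F)c_F ≠ c_F]) (mod 4)` (K41.2, K207.1); `Φ = (c, ρ̄) : G_ℚ → AGL₂(𝔽₂) ≅ S₄`, `Φ(F)` a 4-cycle ⟺ the bit is `1`;
`Φ(G_ℚ) ∈ {S₄, a point-stabiliser S₃}` ⟹ `g` := the quartic field polynomial (Dedekind–Kummer off the index) or `X⁴` (`c` a coboundary: K207.8, the degenerate
`W′ = W` instance is TRUE with `D = 1, g = X⁴, S = ∅`; `W′ = W ⊗ χ_d`: `D = d, g = X⁴`).  What a prover must build: the mod-4 comparison cocycle from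
`HasSurjectiveModNGaloisRep 2` + the trace congruence, and Dedekind–Kummer for a quartic; the six `𝔽₂`-matrix facts are `decide`d in the kernel file.  REF1 falsifier:
split-prime prediction (`bit = scalar = 0 ⟹ a′ ≡ a (mod 4)`, K207.3) 1 262/1 262 on the 213 pairs; its `∃ D` is witnessed by `D = 16δδ′` (up to `·Δ`).  REF2 v54
§17.3/§17.5: SUPPORT-grade, PRINT-ASSEMBLY = v53 §6.3 (T1) (two `ℤ/4`-lifts differ by `1 + 2c`, `[c] ∈ H¹(ℚ, ad ρ̄)`; Mazur) + (T2) (first-order trace expansion;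
transposition-prime trace theorem via the halving criterion) + (T3) the `S₄`-field is `ℚ(x(E[4]))` (Yelton 2015, Thm. 3.1) — = -es §29–30 in trace language plus the
`S₄` packaging of the digit bit, «the second 2-adic digit of a mod-2 congruence is a quartic-field splitting bit plus `χ_D` on odd traces».  FOLD -ty g19 (REF2 v54 §19
slot-read NIT): the print home of this row is (T1) Mazur 1989 deformation theory (two `ℤ/4`-lifts of `ρ̄` with equal determinant differ by `1 + 2c`, `[c] ∈ H¹(ℚ, ad ρ̄)`), (T2) the
first-order trace expansion, (T3) Yelton 2015 (cite added above, verified on held arXiv 1310.6447 p0008–p0009); -an's Dummigan §2 tag is kept as CONTEXT (his §2 = standing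
hypotheses (1)–(4) + the `Sym²V ≅ Ad⁰ρ̄` dictionary), not as a source for the digit law.) -/
def CongruentCurvesDigitLawAtTwo : Prop :=
  ∀ (W W' : WeierstrassCurve ℚ) [W.IsElliptic] [W'.IsElliptic] [W.IsGloballyMinimal] [W'.IsGloballyMinimal]
    [W.IsIntegral ℤ] [W'.IsIntegral ℤ],
    W.HasSurjectiveModNGaloisRep 2 →
    (∀ ℓ : ℕ, ∀ _h : Fact ℓ.Prime, ℓ ≠ 2 → W.HasGoodReductionAtPrime ℓ → W'.HasGoodReductionAtPrime ℓ →
        Even (W.frobeniusTrace ℓ - W'.frobeniusTrace ℓ)) →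
    ∃ (D : ℤ) (g : Polynomial ℤ) (S : Finset ℕ), D ≠ 0 ∧ g.Monic ∧ g.natDegree = 4 ∧
      ∀ ℓ : ℕ, ℓ.Prime → ℓ ∉ S →
        (4 : ℤ) ∣ W'.frobeniusTrace ℓ - W.frobeniusTrace ℓ -
          2 * ((if Odd (W.frobeniusTrace ℓ) ∧ jacobiSym D ℓ = -1 then 1 else 0) +
               (if Irreducible (g.map (Int.castRingHom (ZMod ℓ))) then 1 else 0))

/-! ### §41.3 AN-41c — the prime-level scalar law (CONJECTURE; census 26/26) -/

/-- **AN-41c `PrimeLevelScalarDigitLawAtTwo` (CONJECTURE; census of ALL 26 congruent pairs of optimal curves of equal PRIME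
conductor `N < 5000`).**  If `E, E'` are elliptic curves of the same prime conductor `N`, `ρ̄_{E,2}` surjective, congruent mod `2`,
then the scalar character of AN-41b is `1` or `χ₋₄` MODULO THE INVISIBLE `χ_{N*}` (`N* = ±N` the discriminant kernel field: `χ_{N*} = +1` at every `a_ℓ`-odd prime, so `χ_D` and `χ_{DN*}` give the same law) — never `χ_{±8}·(…)`: EITHER `a_ℓ(E') ≡ a_ℓ(E) (mod 4)` at every good
odd prime with `a_ℓ(E)` odd, OR `a_ℓ(E') ≡ χ₋₄(ℓ)·a_ℓ(E) (mod 4)` at every such prime.  (`χ_{±8}` is excluded conjecturally by finite flatness at `2` of both `ρ_{E,4}`, `ρ_{E',4}` — the `p = 2` subtlety; -es §30 (L-ss-iii) proves `D ≡ 1 (mod 4)` when BOTH are supersingular at `2`; census: `13` pairs with `h = 0`, `13` with `h = h₄`,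
`0` other, `0` exceptions at `p ≤ 700`.)  Why it might fail: a pair at larger `N` whose `2`-adic local types at `2` differ by
`χ₈ (mod 4)`; non-optimal members of the isogeny class are not excluded here (isogenies are odd-degree under surjectivity, fine).
(Typer -ty g19, REF1-AUDIT §207: **SURVIVES, THEOREM-GRADE AND DECIDED** — filed VERBATIM with `@[conjecture]` (R207a: «keep `@[conjecture]` until a tree proof exists»;
R207c(i)'s `↔`-sharpening needs a carrier for matched 2-torsion abscissae the tree does not have — not applied).  (A2): on the `a_ℓ(W)`-odd primes (= 3-cycle primes,
K207.2′) the second disjunct reads `a′ − a ≡ 2·𝟙_{ℓ≡3(4)}`; both disjuncts TRUE at `W′ = W`.  DECIDED (REF1, paper + `pred41c.py`): with `Γ = G_{ℚ(E[2])}`,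
`ρ_{E,4}|Γ = 1 + 2A`, Weil ∘ Kummer = 2-descent (Silverman X.1) gives `e₂(A(γ)Tᵢ, Tⱼ) = κ(eᵢ − eⱼ)(γ)`, the scalar projection of `M|Γ = A + A′` is
`h|Γ = κ(δδ′)`, `δ := ∏_{i<j}(eᵢ − eⱼ)`, and `D := 16δδ′ ∈ ℚ×` has `D² = ΔΔ′` EXACTLY (= ES-30b's normalisation, with a SIGN); `h ∈ {χ_D, χ_D·χ_Δ}` (K207.9: `h` is
defined only modulo `sgn∘ρ̄ = χ_{ℚ(√Δ)}` — THIS, not `χ_{N*}`, is the «invisible» character of the docstring; they agree on 3-cycle primes, R207b); at `N = N′` prime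
`Δ = sN^k, Δ′ = sN^{k′}` (`k, k′` odd: 426/426 curves), `D = ±N^{(k+k′)/2}`, so type `1` ⟺ `D ∈ {1, Δ}·ℚ²`, type `χ₋₄` ⟺ `−D ∈ {1, Δ}·ℚ²`.  Falsifier widened
26 → 213 congruent pairs with `ρ̄` onto at prime `N < 5·10⁵` (`REF1-data/b207/scan41.txt`): 129 type `1` / 84 type `χ₋₄` / 0 other, predicted type = observed type
213/213 from the cubics alone (no `a_p` enters); `χ₋₄` ⟹ ordinary at `2` 84/84, common supersingular `2` ⟹ type `1` 62/62 (= -es (L-ss-iii), ES-30c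
`SupersingularScalarCharacterCongruence`); the docstring's «13 pairs with `h = 0`, 13 with `h = h₄`» reads 12/14 in -an's own `k3_pairs_out.txt` and in REF1's engine
(R207b).  REF2 v54 §17.3/§17.5: SUPPORT = the equal-prime-level corner of ES-30b `ScalarCharacterLaw` (`F1Sign2/ScalarCharacterAtTwo.lean`): `D = ±N^k`,
`χ_{±N}(ℓ) = 1` at 3-cycle primes ⟹ `ψ(ℓ) ∈ {1, χ₋₄(ℓ)}` — a cross-check of ES-30 at equal level, not an independent conjecture; «no `χ_{±8}`» is simply «`D = ±N^m` is
odd»; the one conjecture-grade corner left is R207d(iii) «`E` supersingular at `2` ⟹ `χ_{16δδ′}` unramified at `2`» (flatness of `E[4], E′[4]`).) -/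
@[conjecture] def PrimeLevelScalarDigitLawAtTwo : Prop :=
  ∀ (W W' : WeierstrassCurve ℚ) [W.IsElliptic] [W'.IsElliptic] [W.IsGloballyMinimal] [W'.IsGloballyMinimal]
    [W.IsIntegral ℤ] [W'.IsIntegral ℤ] [NeZero (W.conductorNorm ℤ)] [NeZero (W'.conductorNorm ℤ)],
    (W.conductorNorm ℤ).Prime → W'.conductorNorm ℤ = W.conductorNorm ℤ → W.HasSurjectiveModNGaloisRep 2 →
    (∀ ℓ : ℕ, ∀ _h : Fact ℓ.Prime, ℓ ≠ 2 → ℓ ≠ W.conductorNorm ℤ → Even (W.frobeniusTrace ℓ - W'.frobeniusTrace ℓ)) →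
    (∀ ℓ : ℕ, ∀ _h : Fact ℓ.Prime, ℓ ≠ 2 → ℓ ≠ W.conductorNorm ℤ → Odd (W.frobeniusTrace ℓ) →
        (4 : ℤ) ∣ W'.frobeniusTrace ℓ - W.frobeniusTrace ℓ) ∨
    (∀ ℓ : ℕ, ∀ _h : Fact ℓ.Prime, ℓ ≠ 2 → ℓ ≠ W.conductorNorm ℤ → Odd (W.frobeniusTrace ℓ) →
        (4 : ℤ) ∣ W'.frobeniusTrace ℓ - (if ℓ % 4 = 3 then -1 else 1) * W.frobeniusTrace ℓ)

end Summit.BirchSwinnertonDyer.Rank1Residual.F1Sign2.ANg24
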